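import Mathlib
import Summits.NavierStokesRegularity.NavierStokesRegularity.Theorems.TaoLadderRungTwoBreakOneShiftFrameRowsTop
import HarnessLib

/-!
# Kernel STAGE 3, frame rows (self-map side): STAGE 2 Lemma 4's wake/top self-map rows for all tail shells
# from the first one, on a geometric frame (cell harvest/h2-tao-ladder, seat p2; rung1/KERNEL-STAGE3-PLAN.md
# brick (7); support for K1(1) = `NoSurvivingDSSOne`, stmt-NavierStokesRegularity-20205)

MODEL lattice ODEs only; nothing about the Navier–Stokes equations; no item closed; CONDITIONAL glue.
The self-map rows of `…_v3/_v4` read `g_hi tubeR_{k+1} + dev_k + τ_hi R_k ≤ tubeR_k` for tail shells `k` whose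
partner `k+1` is a tail shell. WAKE: if the frame's tube radii satisfy the recursion with slack
`tubeR_{-(j+2)} ≥ g_hi tubeR_{-(j+1)} + κ ξ^{j+2}` (STAGE 2: `r̃_{j+1} = ζ r̃_j + κ`, ξ = ĝ) and the centre mismatch /
rates have envelopes `d̄ δ^{j+2}`, `r̄ σ^{j+2}` with `δ, σ ≤ ξ`, the rows hold for all `j` as soon as
`d̄ δ² + τ_hi r̄ σ² ≤ κ ξ²` (`wake_selfRows_of_first`). TOP: with `tubeR_{W+j} = ε ϑ_A^j`, `dev = 0`, rates
`≤ r̄_t σ_t^j`, `σ_t ≤ ϑ_A`, all rows follow from `g_hi ε ϑ_A + τ_hi r̄_t ≤ ε` (`top_selfRows_of_first`).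
-/

noncomputable section

-- `Summit.NavierStokesRegularity.NavierStokesRegularity.…` is the tree's (summit = problem) namespace; the
-- duplicated component is intended, so the dupNamespace linter is silenced for this file.
set_option linter.dupNamespace false

namespace Summit.NavierStokesRegularity.NavierStokesRegularity.Theorems

namespace DSSOneShift

open Set MeasureTheory intervalIntegral
open Literature.Analysis.FluidPDE Literature.Analysis.FluidPDE.TaoCascade CertificateGlueOn

variable {m : ℕ}

namespace OneShiftFrame

variable (F : OneShiftFrame m)

/-- **WAKE SELF-MAP ROWS FROM THE FIRST.** [cite: Tao2016AveragedNS, §4 Lemma 4.1 (4.8); cell vocabulary, harvest/h2-tao-ladder rung1/STAGE2-LEMMA.md §3 Lemma 4(a) (r̃_{j+1} = ζ r̃_j + κ, κ ≥ κ_min)] -/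
theorem wake_selfRows_of_first {gHi κ ξ dbar δ rbar σ : ℝ} {R devC : ℤ → ℝ}
    (hξ : 0 ≤ ξ) (hδ : 0 ≤ δ) (hδξ : δ ≤ ξ) (hσ : 0 ≤ σ) (hσξ : σ ≤ ξ) (hdbar : 0 ≤ dbar) (hrbar : 0 ≤ rbar)
    (hrec : ∀ j : ℕ, gHi * F.tubeR (-(j : ℤ) - 1) + κ * ξ ^ (j + 2) ≤ F.tubeR (-(j : ℤ) - 2))
    (hdev : ∀ j : ℕ, devC (-(j : ℤ) - 2) ≤ dbar * δ ^ (j + 2))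
    (hR : ∀ j : ℕ, R (-(j : ℤ) - 2) ≤ rbar * σ ^ (j + 2))
    (hfirst : dbar * δ ^ 2 + F.τhi * (rbar * σ ^ 2) ≤ κ * ξ ^ 2) (j : ℕ) :
    gHi * F.tubeR (-(j : ℤ) - 2 + 1) + devC (-(j : ℤ) - 2) + F.τhi * R (-(j : ℤ) - 2) ≤
      F.tubeR (-(j : ℤ) - 2) := by
  have hτ := F.τhi_pos.le
  have e1 : (-(j : ℤ) - 2 + 1) = -(j : ℤ) - 1 := by ring
  rw [e1]
  have hξj : 0 ≤ ξ ^ j := pow_nonneg hξ j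
  have h1 : devC (-(j : ℤ) - 2) ≤ dbar * δ ^ 2 * ξ ^ j := by
    refine (hdev j).trans ?_
    rw [show dbar * δ ^ (j + 2) = dbar * δ ^ 2 * δ ^ j by ring]
    exact mul_le_mul_of_nonneg_left (pow_le_pow_left₀ hδ hδξ j) (by positivity)
  have h2 : F.τhi * R (-(j : ℤ) - 2) ≤ F.τhi * (rbar * σ ^ 2) * ξ ^ j := by
    have h := hR j
    calc F.τhi * R (-(j : ℤ) - 2) ≤ F.τhi * (rbar * σ ^ (j + 2)) := mul_le_mul_of_nonneg_left h hτ
      _ = F.τhi * (rbar * σ ^ 2) * σ ^ j := by ring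
      _ ≤ F.τhi * (rbar * σ ^ 2) * ξ ^ j :=
          mul_le_mul_of_nonneg_left (pow_le_pow_left₀ hσ hσξ j) (by positivity)
  have h3 : dbar * δ ^ 2 * ξ ^ j + F.τhi * (rbar * σ ^ 2) * ξ ^ j ≤ κ * ξ ^ (j + 2) := by
    rw [show κ * ξ ^ (j + 2) = κ * ξ ^ 2 * ξ ^ j by ring, ← add_mul]
    exact mul_le_mul_of_nonneg_right hfirst hξj
  linarith [hrec j]

/-- **TOP SELF-MAP ROWS FROM THE FIRST.** [cite: Tao2016AveragedNS, §4 Lemma 4.1 (4.8); cell vocabulary, harvest/h2-tao-ladder rung1/STAGE2-LEMMA.md §3 Lemma 4(b) (g_hi/Γ + drift ≤ 1)] -/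
theorem top_selfRows_of_first {gHi ε ϑA rbart σt : ℝ} {R devC : ℤ → ℝ}
    (hϑA : 0 < ϑA) (hσt : 0 ≤ σt) (hσtϑ : σt ≤ ϑA) (hrbart : 0 ≤ rbart)
    (htube : ∀ j : ℕ, F.tubeR ((F.W : ℤ) + j) = ε * ϑA ^ j)
    (hdev : ∀ j : ℕ, devC ((F.W : ℤ) + j) ≤ 0) (hR : ∀ j : ℕ, R ((F.W : ℤ) + j) ≤ rbart * σt ^ j)
    (hfirst : gHi * (ε * ϑA) + F.τhi * rbart ≤ ε) (j : ℕ) :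
    gHi * F.tubeR ((F.W : ℤ) + j + 1) + devC ((F.W : ℤ) + j) + F.τhi * R ((F.W : ℤ) + j) ≤
      F.tubeR ((F.W : ℤ) + j) := by
  have hτ := F.τhi_pos.le
  have e1 : ((F.W : ℤ) + j + 1) = (F.W : ℤ) + ((j + 1 : ℕ) : ℤ) := by push_cast; ring
  rw [e1, htube (j + 1), htube j]
  have hϑj : 0 ≤ ϑA ^ j := pow_nonneg hϑA.le j
  have h2 : F.τhi * R ((F.W : ℤ) + j) ≤ F.τhi * rbart * ϑA ^ j := by
    calc F.τhi * R ((F.W : ℤ) + j) ≤ F.τhi * (rbart * σt ^ j) := mul_le_mul_of_nonneg_left (hR j) hτ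
      _ ≤ F.τhi * (rbart * ϑA ^ j) :=
          mul_le_mul_of_nonneg_left (mul_le_mul_of_nonneg_left (pow_le_pow_left₀ hσt hσtϑ j) hrbart) hτ
      _ = F.τhi * rbart * ϑA ^ j := by ring
  have h3 : gHi * (ε * ϑA ^ (j + 1)) + F.τhi * rbart * ϑA ^ j ≤ ε * ϑA ^ j := by
    have : gHi * (ε * ϑA ^ (j + 1)) + F.τhi * rbart * ϑA ^ j = (gHi * (ε * ϑA) + F.τhi * rbart) * ϑA ^ j := by
      ring
    rw [this]
    exact mul_le_mul_of_nonneg_right hfirst hϑj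
  linarith [hdev j]

end OneShiftFrame

end DSSOneShift

end Summit.NavierStokesRegularity.NavierStokesRegularity.Theorems
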